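import Summits.BirchSwinnertonDyer.BirchSwinnertonDyer.Theorems.InertBadSignedBranchesInertBadAtThreeIstarZeroOfEtaMC
import HarnessLib

/-!
# Route `InertBadSignedBranches` (rung K8, rev 5), D71 child `InertBadAtThreeIstarZero` (stmt-BirchSwinnertonDyer-19656):
# the η-side normal form of the child RE-KEYED to the route's CURRENT items (D92, planner g15):
# child ⟸ law@3 ∧ `PlusMCEtaK` (19501) ∧ `SignedReadingFacts` (19502) ∧ `PublishedFactsInert` (19227)
# (helper `--supports` 19656; cell `bsd-cm`, seat `bsd-cm-k8i-c41` g3; bookkeeping only, nothing asserted)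

HONEST FRAMING (cell `bsd-cm`, run/shared/lean/pub/bsd-cm/): Birch–Swinnerton-Dyer is NOT proved by
any of this; the child is OPEN at class level. Route rev 4/5 (D92, 2026-08-26T08:04Z) replaced the
support item `PrintReadingsInert` by the crux `PlusMCEtaK` (Kobayashi's even main conjecture at `η`
for CM `V`, K_∞-form, EVERY ODD `p` — «so that the SAME item serves the p ≥ 5 assembly and the p = 3
child 19656») and the named-fact pair `SignedReadingFacts`. g2's η-side theorems of this base
(`InertBadOddEta.inertBadAtThreeIstarZero_of_pairLawAtThree_of_kobayashi74_of_plusMCEtaK` /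
`…_of_etaGZValuationAtThree_…`, p424944) carry those inputs as SPELLED-OUT binders (`hC1K₃`, `hKO`,
`h74`); this file restates them with the route decls BY NAME, so the cone reads: **19656 ⟸ (η-branch
`3`-adic Gross–Zagier law on the type, pair/LEVEL or print/LOG currency — NOT a route item, in no
source) ∧ 19501 ∧ 19502 ∧ 19227**. `PlusMCEtaK` is instantiated at `p = 3` (`3 ≠ 2`; its period clause
`if Even (3/2) … else …` is the imaginary-period one). THEOREMS ONLY: 0 definitions, 0 named facts,
0 `sorry`.

PARTITION (D-0054): CornerF inert-bad (B12 / O10) × O10-PS@3 (57 classes of signed type `(3, I₀*)`) ×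
`p = 3` — none (re-keying; closes no cell, no item; no label moves).

References (locators only): [Kobayashi2003] §4 p. 8, Thm. 7.4; [KitajimaOtsuki2018] Main Thm. 1.3;
[PollackRubin2004] p. 448 (remark); [Miller2011LMS] Def. 1.1.
-/

set_option autoImplicit false
set_option linter.dupNamespace false

noncomputable section

open scoped Classical NumberField
open CongruenceSubgroup Field Function NumberField IsDedekindDomain IsDedekindDomain.HeightOneSpectrum
  WeierstrassCurve Rat.HeightOneSpectrum
open Literature.NumberTheory.EllipticCurves
open Literature.NumberTheory.EllipticCurves.ModularForms
open Literature.NumberTheory.EllipticCurves.Rank1Residual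
open Literature.NumberTheory.EllipticCurves.Rank1Residual.Typed
open Literature.NumberTheory.GaloisRepresentations
open Literature.NumberTheory.GaloisCohomology
open ZpExtension
open Summit.BirchSwinnertonDyer.Rank1Residual
open Summit.BirchSwinnertonDyer.Rank1Residual.Additive
open Summit.BirchSwinnertonDyer.Rank1Residual.Additive.LocalLog
open Summit.BirchSwinnertonDyer.Rank1Residual.X12
open Summit.BirchSwinnertonDyer.Rank1Residual.X12.O10
open Summit.BirchSwinnertonDyer.BirchSwinnertonDyer.Theses.InertBadSignedBranches

namespace Summit.BirchSwinnertonDyer.BirchSwinnertonDyer.Theorems.InertBadOddEta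

/-- `PlusMCEtaK` (item 19501, every odd `p`) read at `p = 3`: Kobayashi's even main conjecture at `η`
for CM `V` good supersingular at `3`, with the imaginary-period normalisation (`3/2 = 1` is odd) —
exactly the binder `hC1K₃` of g2's `p = 3` theorems. Bookkeeping. [cite: Kobayashi2003, §4 (p. 8)] -/
theorem plusMCEtaK_three (hK : PlusMCEtaK) :
    ∀ (K₀ : Type) [Field K₀] [NumberField K₀] [IsCyclotomicExtension {3} ℚ K₀]
        [(galRange (K := ℚ) K₀).Normal] (ηχ : absoluteGaloisGroup ℚ →* ℤˣ),
        (∀ σ ∈ galRange (K := ℚ) K₀, ηχ σ = 1) → ηχ ≠ 1 →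
      ∀ (V : WeierstrassCurve ℚ) [V.IsElliptic] [V.IsGloballyMinimal] {N : ℕ} [NeZero N]
        {f : CuspForm (Gamma0 N) 2}, V.HasCM →
        (3 : ℕ) ≠ 2 → V.HasGoodReductionAtPrime 3 → V.frobeniusTrace 3 = 0 → IsNewformOf V f →
      ∀ (ϖ : ℚ), (ϖ : ℝ) * V.imaginaryPeriodRat = minusPeriod f →
      ∀ (κ : ZpExtension ℚ 3) (γ : absoluteGaloisGroup ℚ),
        κ.IsCyclotomic → κ.IsTopGenerator γ → γ ∈ galRange (K := ℚ) K₀ → IsCyclotomicVariable 3 γ →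
      ∀ (Lp : IwasawaAlgebra 3), Additive.IsQuadraticBranchPlusLFunction f 3 ϖ Lp →
      ∀ D : Additive.EtaSignedSelmerDualData V κ K₀ ℚ_[3] ηχ γ 1, D.charIdeal = Ideal.span {Lp} := by
  have hK' := hK
  unfold PlusMCEtaK at hK'
  have hodd : ¬ Even (3 / 2) := by decide
  intro K₀ _ _ _ _ ηχ hηK hη1 V _ _ N _ f hCM hp2 hgood hap hf ϖ hϖ κ γ hκ hγ hγK hγc Lp hLp D
  exact hK' 3 hp2 K₀ ηχ hηK hη1 V hCM hgood hap hf ϖ (by rw [if_neg hodd]; exact hϖ) κ γ hκ hγ hγK hγc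
    Lp hLp D

/-- **19656 ⟸ law@3 (pair/LEVEL form) ∧ `PlusMCEtaK` ∧ `SignedReadingFacts` ∧ `PublishedFactsInert`** —
g2's `inertBadAtThreeIstarZero_of_pairLawAtThree_of_kobayashi74_of_plusMCEtaK` with its three spelled-out
inputs supplied BY NAME from the route items 19501 / 19502 / 19227 (rev 5). The one binder that is not a
route item, `hlaw₃`, is the η-branch `3`-adic Gross–Zagier valuation law on the type in pair/LEVEL
currency (the δ-free text of the crux `CccOneLawOnTypeIstarZero` read at `p = 3`; the typed C-cc-1 object
is vacuous at `3`) — in NO source. CONDITIONAL; nothing booked; the child stays OPEN.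
[cite: Kobayashi2003, §4 (p. 8) and Thm. 7.4] [cite: KitajimaOtsuki2018, Main Thm. 1.3] [cite: Miller2011LMS, Def. 1.1] -/
theorem inertBadAtThreeIstarZero_of_pairLawAtThree_of_routeItems
    (hlaw₃ : ∀ (W : WeierstrassCurve ℚ) [W.IsElliptic] [W.IsGloballyMinimal],
      HasSignedLocalType W 3 (.Istar 0) → W.analyticRank = 1 →
      ∀ (V : WeierstrassCurve ℚ) [V.IsElliptic] [V.IsGloballyMinimal] (C : VariableChange ℚ)
        {N : ℕ} [NeZero N] {f : CuspForm (Gamma0 N) 2},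
        C • W.quadraticTwist (-3) = V →
        V.HasGoodReductionAtPrime 3 → V.frobeniusTrace 3 = 0 → IsNewformOf V f →
        ∀ (ϖ : ℚ), (ϖ : ℝ) * V.imaginaryPeriodRat = minusPeriod f →
        ∀ (L : IwasawaAlgebra 3), IsQuadraticBranchMinusLFunction f 3 ϖ L →
        (∀ Q : (W.baseChange ℚ_[3]).toAffine.Point, 3 • Q = 0 → Q = 0) →
        ∀ (P : W.toAffine.Point) (n : ℕ), ¬ IsOfFinAddOrder P →
        (∀ R : W.toAffine.Point, ∃ (k : ℤ) (T : W.toAffine.Point), IsOfFinAddOrder T ∧ R = k • P + T) →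
        (∃ Q : (W.baseChange ℚ_[3]).toAffine.Point, 3 ^ n • Q = W.toPadicPoint 3 P) →
        (∀ Q : (W.baseChange ℚ_[3]).toAffine.Point, 3 ^ (n + 1) • Q ≠ W.toPadicPoint 3 P) →
        ∀ (q : ℚ), shaAn W = (q : ℂ) →
        PowerSeries.coeff 1 L ≠ 0 ∧
          ((PowerSeries.coeff 1 L : ℤ_[3]) : ℚ_[3]).valuation =
            2 * (n : ℤ) + padicValRat 3 (q * W.tamagawaProduct / (W.torsionOrder : ℚ) ^ 2))
    (hK : PlusMCEtaK) (hR : SignedReadingFacts) (h₆ : PublishedFactsInert) :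
    Summit.BirchSwinnertonDyer.BirchSwinnertonDyer.Theses.InertBadSignedBranches.InertBadAtThreeIstarZero :=
  inertBadAtThreeIstarZero_of_pairLawAtThree_of_kobayashi74_of_plusMCEtaK hlaw₃ (plusMCEtaK_three hK)
    hR.1 hR.2 h₆

/-- **19656 ⟸ (GZ_η-VAL)@3 (print/LOG form) ∧ `PlusMCEtaK` ∧ `SignedReadingFacts` ∧ `PublishedFactsInert`**
— the LOG-currency twin (g2's `inertBadAtThreeIstarZero_of_etaGZValuationAtThree_of_kobayashi74_of_plusMCEtaK`
re-keyed to the route items 19501 / 19502 / 19227). CONDITIONAL; nothing booked; the child stays OPEN.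
[cite: Kobayashi2003, §4 (p. 8) and Thm. 7.4] [cite: KitajimaOtsuki2018, Main Thm. 1.3] [cite: Miller2011LMS, Def. 1.1] -/
theorem inertBadAtThreeIstarZero_of_etaGZValuationAtThree_of_routeItems
    (hGZη₃ : ∀ (W : WeierstrassCurve ℚ) [W.IsElliptic] [W.IsGloballyMinimal],
      HasSignedLocalType W 3 (.Istar 0) → W.analyticRank = 1 →
      ∀ (V : WeierstrassCurve ℚ) [V.IsElliptic] [V.IsGloballyMinimal] (C : VariableChange ℚ)
        {N : ℕ} [NeZero N] {f : CuspForm (Gamma0 N) 2},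
        C • W.quadraticTwist (-3) = V →
        V.HasGoodReductionAtPrime 3 → V.frobeniusTrace 3 = 0 → IsNewformOf V f →
        ∀ (ϖ : ℚ), (ϖ : ℝ) * V.imaginaryPeriodRat = minusPeriod f →
        ∀ (L : IwasawaAlgebra 3), IsQuadraticBranchMinusLFunction f 3 ϖ L →
        ∀ (P : W.toAffine.Point), ¬ IsOfFinAddOrder P →
        (∀ R : W.toAffine.Point, ∃ (k : ℤ) (T : W.toAffine.Point), IsOfFinAddOrder T ∧ R = k • P + T) →
        ∀ (q : ℚ), W.leadingLCoeff / ((W.realPeriodRat * W.regulator : ℝ) : ℂ) = (q : ℂ) →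
        PowerSeries.coeff 1 L ≠ 0 ∧
          ((PowerSeries.coeff 1 L : ℤ_[3]) : ℚ_[3]).valuation =
            2 * (padicLog (W.baseChange ℚ_[3]) (W.toPadicPoint 3 P)).valuation + padicValRat 3 q)
    (hK : PlusMCEtaK) (hR : SignedReadingFacts) (h₆ : PublishedFactsInert) :
    Summit.BirchSwinnertonDyer.BirchSwinnertonDyer.Theses.InertBadSignedBranches.InertBadAtThreeIstarZero :=
  inertBadAtThreeIstarZero_of_etaGZValuationAtThree_of_kobayashi74_of_plusMCEtaK hGZη₃ (plusMCEtaK_three hK)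
    hR.1 hR.2 h₆

end Summit.BirchSwinnertonDyer.BirchSwinnertonDyer.Theorems.InertBadOddEta

end
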